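import Mathlib.Algebra.Homology.HomotopyCategory.Acyclic
import Mathlib.Algebra.Homology.HomotopyCategory.Pretriangulated
import Mathlib.Algebra.Homology.HomotopyCategory.MappingCone
import Mathlib.Algebra.Homology.HomotopyCategory.Plus
import Mathlib.Algebra.Homology.ShortComplex.ExactFunctor
import Mathlib.Algebra.Homology.Embedding.CochainComplex
import Mathlib.Tactic.Ring
import HarnessLib

/-!
# A left exact functor preserves acyclicity of bounded-below complexes of acyclic objects
# (and quasi-isomorphisms between bounded-below complexes of acyclic objects)

Topic `Algebra/Homology`; namespace `Literature.Algebra.Homology`. Pure homological algebra; everything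
proved, no named fact.

Let `F : C ⥤ D` be an additive LEFT EXACT functor between abelian categories and `P` a class of
objects of `C` which is **`F`-acyclic** in the effaceable sense (`AcyclicClass F P`): `P` contains the
zero objects, is closed under extensions and under cokernels of monomorphisms `X₁ ↪ X₂` with
`X₁, X₂ ∈ P`, and `F` carries every short exact `0 → X₁ → X₂ → X₃ → 0` with `X₁ ∈ P` to an epimorphism
`F X₂ ↠ F X₃` (hence to a short exact sequence). The standard example: `P = {X | Rⁱ F (X) = 0, i > 0}`
(derived-functor acyclic objects) — or, WITHOUT derived functors, any class on which a cohomological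
`δ`-functor effacing `F` vanishes (this tree: `Literature/AlgebraicGeometry/Modules/PushforwardAcyclicResolution`,
where `F = f_*` and the vanishing is Serre's Tag 01XB on affines).

* `AcyclicClass.shortExact_map` — `F` preserves short exact sequences starting in `P`.
* `AcyclicClass.of_iso`, `AcyclicClass.biprod` — closure under isomorphisms and binary biproducts.
* `AcyclicClass.cycles_mem` — for a bounded-below ACYCLIC cochain complex `K` with terms in `P`, every
  cycle object `Zⁿ(K)` lies in `P`.
* **`AcyclicClass.acyclic_map`** — `F K` is acyclic for such `K` (Leray's acyclicity lemma: a
  bounded-below acyclic complex of `F`-acyclic objects stays acyclic under `F`; Hartshorne III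
  Prop. 1.2A; Weibel Exercise 2.4.3 (dimension shifting) in complex form):
  `0 → Zⁿ → Kⁿ → Zⁿ⁺¹ → 0` are short exact with `Zⁿ ∈ P`, so stay short exact under `F`, and `F dⁿ`
  factors as `F Kⁿ ↠ F Zⁿ⁺¹ ↪ F Kⁿ⁺¹`.
* `quasiIso_iff_acyclic_mappingCone` — a morphism of cochain complexes is a quasi-isomorphism iff its
  mapping cone is acyclic (Mathlib's triangulated structure on `K(C)`: `quasiIso = acyclic.trW`).
* **`AcyclicClass.quasiIso_map`** — `F` carries quasi-isomorphisms between bounded-below complexes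
  with terms in `P` to quasi-isomorphisms (apply `acyclic_map` to the mapping cone, which `F` preserves:
  Mathlib `CochainComplex.mappingCone.mapHomologicalComplexIso`). With `P ⊇ {injectives}` this is
  "`RF` may be computed on `F`-acyclic resolutions" (Hartshorne III.1.2A) in the form
  `F(E) → F(I)` is a quasi-isomorphism for an injective resolution `E → I` of an `F`-acyclic complex.

## References
* R. Hartshorne, *Algebraic Geometry*, GTM 52 (1977), III Prop. 1.2A. [Hartshorne1977]
* C. A. Weibel, *An introduction to homological algebra* (1994), Exercise 2.4.3, Cor. 1.5.4,
  §1.5.1. [Weibel1994]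
-/

noncomputable section

open CategoryTheory CategoryTheory.Limits CategoryTheory.Category ZeroObject

namespace Literature.Algebra.Homology

universe v v' u u'

variable {C : Type u} [Category.{v} C] [Abelian C] {D : Type u'} [Category.{v'} D] [Abelian D]

/-- **An `F`-acyclic class of objects** for an additive left exact functor `F` (effaceable form, no
derived functors): contains the zero objects, closed under extensions and under cokernels of
monomorphisms between members, and `F` is right exact on short exact sequences that START in the
class. (Weibel §2.4: the `F`-acyclic objects of a left exact functor have these properties by the
long exact sequence of `R•F`.) [cite: Weibel1994, §2.4 (Exercise 2.4.3)] -/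
structure AcyclicClass (F : C ⥤ D) (P : ObjectProperty C) : Prop where
  /-- zero objects are acyclic -/
  zero : ∀ X : C, IsZero X → P X
  /-- closed under extensions -/
  ext : ∀ S : ShortComplex C, S.ShortExact → P S.X₁ → P S.X₃ → P S.X₂
  /-- closed under cokernels of monomorphisms between acyclics -/
  quotient : ∀ S : ShortComplex C, S.ShortExact → P S.X₁ → P S.X₂ → P S.X₃
  /-- `F` is exact on short exact sequences starting with an acyclic -/
  epi_map : ∀ S : ShortComplex C, S.ShortExact → P S.X₁ → Epi (F.map S.g)

namespace AcyclicClass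

variable {F : C ⥤ D} {P : ObjectProperty C} (h : AcyclicClass F P)
include h

omit [Abelian D] in
/-- An acyclic class is closed under isomorphisms (`0 → X → Y → 0 → 0`).
[cite: Weibel1994, §2.4 (Exercise 2.4.3)] -/
theorem of_iso {X Y : C} (e : X ≅ Y) (hX : P X) : P Y :=
  let S : ShortComplex C := ShortComplex.mk e.hom (0 : Y ⟶ (0 : C)) comp_zero
  haveI : IsIso S.f := inferInstanceAs (IsIso e.hom)
  h.ext S (ShortComplex.Splitting.ofIsIsoOfIsZero S inferInstance (isZero_zero C)).shortExact
    hX (h.zero _ (isZero_zero C))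

omit [Abelian D] in
/-- An acyclic class is closed under binary biproducts. [cite: Weibel1994, §2.4 (Exercise 2.4.3)] -/
theorem biprod {X Y : C} (hX : P X) (hY : P Y) : P (X ⊞ Y) :=
  h.ext _ (ShortComplex.Splitting.ofHasBinaryBiproduct X Y).shortExact hX hY

/-! ### Cycles of a bounded-below acyclic complex with acyclic terms are acyclic -/

section Cycles

variable (K : CochainComplex C ℤ)

omit h in
/-- `ι_{Zⁿ} ≫ (Kⁿ → Zⁿ⁺¹) = 0`. [cite: Weibel1994, §2.4 (Exercise 2.4.3)] -/
theorem iCycles_toCycles (n : ℤ) : K.iCycles n ≫ K.toCycles n (n + 1) = 0 := by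
  rw [← cancel_mono (K.iCycles (n + 1)), assoc, HomologicalComplex.toCycles_i, zero_comp,
    HomologicalComplex.iCycles_d]

omit h in
/-- The short complex `Zⁿ —ι→ Kⁿ —d→ Zⁿ⁺¹`. [cite: Weibel1994, §2.4 (Exercise 2.4.3)] -/
abbrev cyclesSC (n : ℤ) : ShortComplex C :=
  ShortComplex.mk (K.iCycles n) (K.toCycles n (n + 1)) (iCycles_toCycles K n)

omit h in
/-- `Zⁿ → Kⁿ → Zⁿ⁺¹` is exact (`Zⁿ = ker dⁿ` and `Zⁿ⁺¹ ↪ Kⁿ⁺¹`). [cite: Weibel1994, §2.4 (Exercise 2.4.3)] -/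
theorem cyclesSC_exact (n : ℤ) : (cyclesSC K n).Exact := by
  have hex : (ShortComplex.mk (K.iCycles n) (K.d n (n + 1)) (by simp)).Exact :=
    ShortComplex.exact_of_f_is_kernel _ (K.cyclesIsKernel n (n + 1) (by simp))
  let φ : cyclesSC K n ⟶ ShortComplex.mk (K.iCycles n) (K.d n (n + 1)) (by simp) :=
    { τ₁ := 𝟙 (K.cycles n)
      τ₂ := 𝟙 (K.X n)
      τ₃ := K.iCycles (n + 1)
      comm₁₂ := by simp
      comm₂₃ := by simp }
  haveI : Epi φ.τ₁ := inferInstanceAs (Epi (𝟙 (K.cycles n)))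
  haveI : IsIso φ.τ₂ := inferInstanceAs (IsIso (𝟙 (K.X n)))
  haveI : Mono φ.τ₃ := inferInstanceAs (Mono (K.iCycles (n + 1)))
  exact (ShortComplex.exact_iff_of_epi_of_isIso_of_mono φ).2 hex

omit h in
/-- If `K` is exact in degree `n + 1` then `Kⁿ → Zⁿ⁺¹` is an epimorphism.
[cite: Weibel1994, §2.4 (Exercise 2.4.3)] -/
theorem epi_toCycles_of_exactAt (n : ℤ) (hK : K.ExactAt (n + 1)) : Epi (K.toCycles n (n + 1)) := by
  have hi : (ComplexShape.up ℤ).prev (n + 1) = n := by rw [CochainComplex.prev]; omega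
  have hk : (ComplexShape.up ℤ).next (n + 1) = n + 1 + 1 := by rw [CochainComplex.next]
  rw [K.exactAt_iff' n (n + 1) (n + 1 + 1) hi hk] at hK
  have h' : Epi (K.toCycles n (n + 1) ≫ (K.cyclesIsoSc' n (n + 1) (n + 1 + 1) hi hk).hom) := by
    rw [HomologicalComplex.toCycles_cyclesIsoSc'_hom]
    exact hK.epi_toCycles
  have h'' := epi_comp (K.toCycles n (n + 1) ≫ (K.cyclesIsoSc' n (n + 1) (n + 1 + 1) hi hk).hom)
    (K.cyclesIsoSc' n (n + 1) (n + 1 + 1) hi hk).inv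
  rwa [assoc, Iso.hom_inv_id, comp_id] at h''

omit h in
/-- **`0 → Zⁿ → Kⁿ → Zⁿ⁺¹ → 0` is short exact** when `K` is exact in degree `n + 1`.
[cite: Weibel1994, §2.4 (Exercise 2.4.3)] -/
theorem cyclesSC_shortExact (n : ℤ) (hK : K.ExactAt (n + 1)) : (cyclesSC K n).ShortExact :=
  haveI := epi_toCycles_of_exactAt K n hK
  ShortComplex.ShortExact.mk' (cyclesSC_exact K n) (inferInstanceAs (Mono (K.iCycles n))) this

omit h in
/-- The cycles of a bounded-below acyclic complex vanish below (and at) the bound.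
[cite: Weibel1994, §2.4 (Exercise 2.4.3)] -/
theorem isZero_cycles_of_le (a : ℤ) [K.IsStrictlyGE a] (hK : K.Acyclic) (n : ℤ) (hn : n ≤ a) :
    IsZero (K.cycles n) := by
  obtain ⟨m, rfl⟩ : ∃ m, n = m + 1 := ⟨n - 1, by omega⟩
  haveI := epi_toCycles_of_exactAt K m (hK _)
  exact IsZero.of_epi (K.toCycles m (m + 1)) (K.isZero_of_isStrictlyGE a m (by omega))

omit [Abelian D] in
/-- **The cycles `Zⁿ` of a bounded-below acyclic complex with `F`-acyclic terms are `F`-acyclic**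
(induction along `0 → Zⁿ → Kⁿ → Zⁿ⁺¹ → 0`). [cite: Weibel1994, §2.4 (Exercise 2.4.3)] -/
theorem cycles_mem (a : ℤ) [K.IsStrictlyGE a] (hK : K.Acyclic) (hKP : ∀ n, P (K.X n)) (n : ℤ) :
    P (K.cycles n) := by
  suffices H : ∀ m : ℕ, P (K.cycles (a + m)) by
    by_cases hn : n ≤ a
    · exact h.zero _ (isZero_cycles_of_le K a hK n hn)
    · obtain ⟨m, hm⟩ := Int.le.dest (le_of_not_ge hn)
      rw [← hm]
      exact H m
  intro m
  induction m with
  | zero => exact h.zero _ (isZero_cycles_of_le K a hK (a + (0 : ℕ)) (by simp))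
  | succ m hm =>
    have e : a + ((m + 1 : ℕ) : ℤ) = a + m + 1 := by push_cast; omega
    rw [e]
    exact h.quotient _ (cyclesSC_shortExact K (a + m) (hK _)) hm (hKP _)

variable [F.Additive] [PreservesFiniteLimits F]

/-- **A left exact `F` carries short exact sequences starting with an `F`-acyclic object to short
exact sequences.** [cite: Weibel1994, §2.4 (Exercise 2.4.3)] -/
theorem shortExact_map {S : ShortComplex C} (hS : S.ShortExact) (h₁ : P S.X₁) :
    (S.map F).ShortExact :=
  have hl := (Functor.preservesFiniteLimits_iff_forall_exact_map_and_mono F).1 inferInstance S hS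
  haveI : Mono (S.map F).f := hl.2
  haveI : Epi (S.map F).g := h.epi_map S hS h₁
  ShortComplex.ShortExact.mk' hl.1 inferInstance inferInstance

/-- **Leray's acyclicity lemma (effaceable form)**: a left exact functor carries a bounded-below
ACYCLIC cochain complex with `F`-acyclic terms to an acyclic complex (`F dⁿ = (F Kⁿ ↠ F Zⁿ⁺¹) ≫
(F Zⁿ⁺¹ ↪ F Kⁿ⁺¹)`, both short sequences `0 → F Zⁿ → F Kⁿ → F Zⁿ⁺¹ → 0` being exact).
[cite: Hartshorne1977, III Prop. 1.2A] [cite: Weibel1994, §2.4 (Exercise 2.4.3)] -/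
theorem acyclic_map (a : ℤ) [K.IsStrictlyGE a] (hK : K.Acyclic) (hKP : ∀ n, P (K.X n)) :
    ((F.mapHomologicalComplex (ComplexShape.up ℤ)).obj K).Acyclic := by
  intro n
  obtain ⟨m, rfl⟩ : ∃ m, n = m + 1 := ⟨n - 1, by omega⟩
  have hZ : ∀ i, P (K.cycles i) := cycles_mem h K a hK hKP
  -- `0 → F Z^{m+1} → F K^{m+1} → F Z^{m+2} → 0` and `0 → F Z^m → F K^m → F Z^{m+1} → 0` are short exact
  have hS₀ : ((cyclesSC K (m + 1)).map F).ShortExact :=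
    h.shortExact_map (cyclesSC_shortExact K (m + 1) (hK _)) (hZ _)
  have hS₁ : ((cyclesSC K m).map F).ShortExact :=
    h.shortExact_map (cyclesSC_shortExact K m (hK _)) (hZ _)
  have hi : (ComplexShape.up ℤ).prev (m + 1) = m := by rw [CochainComplex.prev]; omega
  have hk : (ComplexShape.up ℤ).next (m + 1) = m + 1 + 1 := CochainComplex.next ℤ (m + 1)
  rw [HomologicalComplex.exactAt_iff' _ m (m + 1) (m + 1 + 1) hi hk]
  -- `T₁ = (F K^m → F K^{m+1} → F Z^{m+2})`
  have hS₂ : ((cyclesSC K (m + 1 + 1)).map F).ShortExact :=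
    h.shortExact_map (cyclesSC_shortExact K (m + 1 + 1) (hK _)) (hZ _)
  have w : F.map (K.d m (m + 1)) ≫ F.map (K.toCycles (m + 1) (m + 1 + 1)) = 0 := by
    rw [← cancel_mono (F.map (K.iCycles (m + 1 + 1))), zero_comp, assoc, ← F.map_comp,
      HomologicalComplex.toCycles_i, ← F.map_comp, HomologicalComplex.d_comp_d, F.map_zero]
  let T₁ : ShortComplex D := ShortComplex.mk (F.map (K.d m (m + 1)))
    (F.map (K.toCycles (m + 1) (m + 1 + 1))) w
  -- `T₁` is exact: compare with `0 → F Z^{m+1} → F K^{m+1} → F Z^{m+2} → 0` through `F(K^m ↠ Z^{m+1})`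
  have hT₁ : T₁.Exact := by
    let φ₀ : T₁ ⟶ (cyclesSC K (m + 1)).map F :=
      { τ₁ := F.map (K.toCycles m (m + 1))
        τ₂ := 𝟙 _
        τ₃ := 𝟙 _
        comm₁₂ := by
          change F.map (K.toCycles m (m + 1)) ≫ F.map (K.iCycles (m + 1)) = F.map (K.d m (m + 1)) ≫ 𝟙 _
          rw [← F.map_comp, HomologicalComplex.toCycles_i, comp_id]
        comm₂₃ := by
          change 𝟙 _ ≫ F.map (K.toCycles (m + 1) (m + 1 + 1)) = F.map (K.toCycles (m + 1) (m + 1 + 1)) ≫ 𝟙 _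
          rw [comp_id, id_comp] }
    haveI : Epi φ₀.τ₁ := hS₁.epi_g
    haveI : IsIso φ₀.τ₂ := inferInstanceAs (IsIso (𝟙 _))
    haveI : Mono φ₀.τ₃ := inferInstanceAs (Mono (𝟙 _))
    exact (ShortComplex.exact_iff_of_epi_of_isIso_of_mono φ₀).2 hS₀.exact
  -- compare `T₁` with the short complex `F K^m → F K^{m+1} → F K^{m+2}` through `F(Z^{m+2} ↪ K^{m+2})`
  let φ₁ : T₁ ⟶ ((F.mapHomologicalComplex (ComplexShape.up ℤ)).obj K).sc' m (m + 1) (m + 1 + 1) :=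
    { τ₁ := 𝟙 _
      τ₂ := 𝟙 _
      τ₃ := F.map (K.iCycles (m + 1 + 1))
      comm₁₂ := by
        change 𝟙 _ ≫ F.map (K.d m (m + 1)) = F.map (K.d m (m + 1)) ≫ 𝟙 _
        rw [comp_id, id_comp]
      comm₂₃ := by
        change 𝟙 _ ≫ F.map (K.d (m + 1) (m + 1 + 1)) =
          F.map (K.toCycles (m + 1) (m + 1 + 1)) ≫ F.map (K.iCycles (m + 1 + 1))
        rw [← F.map_comp, HomologicalComplex.toCycles_i, id_comp] }
  haveI : Epi φ₁.τ₁ := inferInstanceAs (Epi (𝟙 _))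
  haveI : IsIso φ₁.τ₂ := inferInstanceAs (IsIso (𝟙 _))
  haveI : Mono φ₁.τ₃ := hS₂.mono_f
  exact (ShortComplex.exact_iff_of_epi_of_isIso_of_mono φ₁).1 hT₁

end Cycles

/-! ### Quasi-isomorphisms between bounded-below complexes of acyclic objects -/

section QuasiIso

omit h in
/-- **A morphism of cochain complexes is a quasi-isomorphism iff its mapping cone is acyclic** (the
class of quasi-isomorphisms in `K(C)` is the class of morphisms whose cone lies in the triangulated
subcategory of acyclic complexes, Mathlib `HomotopyCategory.quasiIso_eq_trW_subcategoryAcyclic`).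
[cite: Weibel1994, Cor. 1.5.4] -/
theorem quasiIso_iff_acyclic_mappingCone {K L : CochainComplex C ℤ} (φ : K ⟶ L) :
    QuasiIso φ ↔ (CochainComplex.mappingCone φ).Acyclic := by
  rw [← HomologicalComplex.mem_quasiIso_iff, ← HomotopyCategory.quotient_map_mem_quasiIso_iff,
    HomotopyCategory.quasiIso_eq_trW_subcategoryAcyclic,
    ← HomotopyCategory.quotient_obj_mem_subcategoryAcyclic_iff_acyclic]
  exact (HomotopyCategory.subcategoryAcyclic C).trW_iff_of_distinguished _
    (HomotopyCategory.mappingCone_triangleh_distinguished φ)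

omit h in
/-- The terms of the mapping cone, `Cone(φ)ⁿ ≅ Kⁿ⁺¹ ⊞ Lⁿ`, lie in any class closed under isomorphisms and
binary biproducts that contains the terms of `K` and `L`. [cite: Weibel1994, §1.5.1] -/
theorem mappingCone_X_mem {K L : CochainComplex C ℤ} (φ : K ⟶ L) {Q : ObjectProperty C}
    (hQiso : ∀ {X Y : C}, (X ≅ Y) → Q X → Q Y) (hQbiprod : ∀ {X Y : C}, Q X → Q Y → Q (X ⊞ Y))
    (hK : ∀ n, Q (K.X n)) (hL : ∀ n, Q (L.X n)) (n : ℤ) :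
    Q ((CochainComplex.mappingCone φ).X n) :=
  hQiso (HomologicalComplex.homotopyCofiber.XIsoBiprod φ n (n + 1) rfl).symm (hQbiprod (hK _) (hL _))

variable [F.Additive] [PreservesFiniteLimits F]

/-- **A left exact functor carries quasi-isomorphisms between bounded-below complexes with
`F`-acyclic terms to quasi-isomorphisms** (apply `acyclic_map` to the mapping cone, whose terms
`Kⁿ⁺¹ ⊞ Lⁿ` are acyclic and which `F` preserves). With the injectives inside `P` this is "`RF` is
computed by `F`-acyclic resolutions": `F E → F I` is a quasi-isomorphism for an injective resolution
`E → I` of a bounded-below complex of `F`-acyclic objects.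
[cite: Hartshorne1977, III Prop. 1.2A] [cite: Weibel1994, §2.4 (Exercise 2.4.3)] -/
theorem quasiIso_map {K L : CochainComplex C ℤ} (φ : K ⟶ L) [QuasiIso φ] (a : ℤ) [K.IsStrictlyGE a]
    [L.IsStrictlyGE a] (hK : ∀ n, P (K.X n)) (hL : ∀ n, P (L.X n)) :
    QuasiIso ((F.mapHomologicalComplex (ComplexShape.up ℤ)).map φ) := by
  haveI : (CochainComplex.mappingCone φ).IsStrictlyGE (a - 1) :=
    CochainComplex.isStrictlyGE_mappingCone φ a a (a - 1) (by omega) (by omega)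
  have hc : (CochainComplex.mappingCone φ).Acyclic := (quasiIso_iff_acyclic_mappingCone φ).1 inferInstance
  have hP : ∀ n, P ((CochainComplex.mappingCone φ).X n) :=
    mappingCone_X_mem φ (fun e hX => h.of_iso e hX) (fun hX hY => h.biprod hX hY) hK hL
  have hF := h.acyclic_map (CochainComplex.mappingCone φ) (a - 1) hc hP
  rw [quasiIso_iff_acyclic_mappingCone]
  exact fun i => (hF i).of_iso (CochainComplex.mappingCone.mapHomologicalComplexIso φ F)

end QuasiIso

end AcyclicClass

end Literature.Algebra.Homology

end
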